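import Summits.KontsevichZagierPeriods.KontsevichZagierPeriods.Theorems.LinRedNormalFormHoffmanSpanInKZLeThirteen
import Summits.KontsevichZagierPeriods.KontsevichZagierPeriods.Theorems.LinRedNormalFormHoffmanSpanInKZEdsDSLeaf
import Summits.KontsevichZagierPeriods.KontsevichZagierPeriods.Theorems.FurushoPentagonKernelModuloPeriodConjectureMzvSectorLeafOn
import Summits.KontsevichZagierPeriods.KontsevichZagierPeriods.Theorems.FurushoPentagonDoubleShuffleInKZ
import Summits.KontsevichZagierPeriods.KontsevichZagierPeriods.Theorems.FurushoPentagonIntegerDivision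

/-!
# Crux `LinRedNormalForm.HoffmanSpanInKZ` (stmt-KontsevichZagierPeriods-15044), line `eds-ds`:
# the glue (lever, formal spanning, descent) and THE CRUX THROUGH WEIGHT 17, UNCONDITIONALLY

Line `eds-ds` (strategist `planner-cstrat-stmt-KontsevichZagierPeriods-15044-s1-0`, lead c3). This file
lands the sorry-free part of the skeleton `Cruxes/HoffmanSpanInKZ/Lines/eds_ds.lean` under `Theorems/` and
assembles it with the landed double-shuffle leaf of weights `14 … 17` (`stub_dsLeaf_14_17`,
`…EdsDSLeaf.lean`):

* LEVER `gds_rulesAssociator` — the rules associator `Φ_P ∈ P_ℚ⟨⟨X₀,X₁⟩⟩` satisfies Racinet's generalised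
  double shuffle, UNCONDITIONALLY: the proved item `FurushoPentagon.DoubleShuffleInKZ`
  (`doubleShuffleInKZ_proof`) read at the universal realisation `χ₀ : FormalRep → P_ℚ`;
* `formalSpanW_of_leafDS` — the double-shuffle leaf at `s`, read at `Φ_P` (group-like, GDS, `c_{X₁} = 0`),
  gives `1 ⊗ ⟦ζ(s)⟧ ∈ span_ℚ {1 ⊗ ⟦ζ(t)⟧ : t Hoffman, |t| = |s|}` in `P_ℚ`;
* DESCENT `spanAt_of_formalSpanW` — from `P_ℚ` to the crux's `ℤ`-form: common denominator, `P ↪ P_ℚ` by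
  the proved `IntegerDivision`, rescaling `scaleQ`, division by `IntegerDivision`, off-domain freedom,
  `Negative/Divergence` for non-admissible words;
* `spanAt_of_leafDS`, and the milestones: **`stub_leSeventeen : ∀ N ≤ 17, SpanAt N`** — the crux holds
  UNCONDITIONALLY in every weight `≤ 17` (rungs `≤ 13` of line `Sketch` + the double-shuffle leaf in
  weights `14 … 17`) — and **`stub_cruxOfDsTail`**: the single open stub of the line,
  `stub_dsTail : ∀ s, 18 ≤ |s| → LeafDS s` (Ihara–Kaneko–Zagier 2006, Conjecture 1: regularised EDS is
  Hoffman-complete; OPEN; shared with FurushoPentagon's certificate programme) implies the crux.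

Sources: K. Ihara, M. Kaneko, D. Zagier, Compos. Math. 142 (2006) Thm 2, Conj. 1; G. Racinet, Publ.
Math. IHÉS 95 (2002) Def. 3.1; H. Furusho, Ann. of Math. 174 (2011) §2; M. Kaneko, S. Yamamoto,
Selecta Math. 24 (2018) Thm 4.1; M. Kaneko, M. Noro, K. Tsurumaki, IMA Vol. 148 (2008); F. Brown,
Ann. of Math. 175 (2012) Thm 1.1; M. Kontsevich, D. Zagier, *Periods* (2001), §1.2.
-/

noncomputable section

namespace Summit.KontsevichZagierPeriods.LinRedNormalForm.HoffmanSpanInKZ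

open Literature.NumberTheory.Transcendental
open Literature.NumberTheory.Transcendental.KZ
open Summit.KontsevichZagierPeriods.MzvKernelInKZ.Negative
open Summit.KontsevichZagierPeriods.MzvKernelInKZ.TwoPosets
open Summit.KontsevichZagierPeriods.KontsevichZagierPeriods.Theses.LinRedNormalForm (HoffmanSpanInKZ)
open Summit.KontsevichZagierPeriods.FurushoPentagon.PentagonInKZNegative
  (chiUniv isRealisation_chiUniv simplexZ simplexZ_agrees cruxSeries cruxSeries_chiUniv)
open Summit.KontsevichZagierPeriods.FurushoPentagon.KernelModuloPeriodConjecture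
  (isGroupLike_rulesAssociator formalSpan_neg_one_pow_mul sectorKernel_toPeriodAlgebra_injective)

/-! ## The lever: generalised double shuffle for `Φ_P`, unconditionally -/

/-- **`Φ_P` satisfies Racinet's generalised double shuffle** (unconditionally): the proved item
`DoubleShuffleInKZ` read at the universal realisation `χ₀ : FormalRep → P_ℚ`, whose series is the rules
associator. [cite: IharaKanekoZagier2006, Thm 2] -/
theorem gds_rulesAssociator : NCSeries.GeneralisedDoubleShuffle KZ.rulesAssociator := by
  have h := Summit.KontsevichZagierPeriods.FurushoPentagon.DoubleShuffleInKZ.doubleShuffleInKZ_proof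
    KZ.FormalPeriodAlgebra chiUniv
    isRealisation_chiUniv.rel isRealisation_chiUniv.mul isRealisation_chiUniv.unit simplexZ simplexZ_agrees
  have h' : NCSeries.GeneralisedDoubleShuffle (cruxSeries KZ.FormalPeriodAlgebra chiUniv simplexZ) := h
  rwa [cruxSeries_chiUniv] at h'

/-- **Formal Hoffman spanning from the double-shuffle leaf** (no pentagon, no reducedness): the leaf at
an admissible `s`, read at `Φ_P`, gives `1 ⊗ ⟦ζ(s)⟧ ∈ span_ℚ {1 ⊗ ⟦ζ(t)⟧ : t Hoffman, |t| = |s|}`. -/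
theorem formalSpanW_of_leafDS {s : List ℕ} (hs : MZV.IsAdmissible s) (hA : LeafDS s) :
    toPeriodAlgebra (mzvClass s) ∈ Submodule.span ℚ (Set.range
      (fun t : {t : List ℕ // MZV.IsHoffman t ∧ MZV.weight t = MZV.weight s} =>
        toPeriodAlgebra (mzvClass t.1))) := by
  obtain ⟨b, hb, hall⟩ := hA
  have key := hall FormalPeriodAlgebra rulesAssociator isGroupLike_rulesAssociator gds_rulesAssociator
    rulesAssociator_X₁
  rw [rulesAssociator_binaryWord hs] at key
  have hx : toPeriodAlgebra (mzvClass s) =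
      (-1 : FormalPeriodAlgebra) ^ MZV.depth s *
        b.sum (fun t q => q • rulesAssociator (MZV.binaryWord t)) := by
    rw [← key, ← mul_assoc, ← pow_add, ← two_mul, pow_mul, neg_one_sq, one_pow, one_mul]
  rw [hx, formalSpan_neg_one_pow_mul]
  refine Submodule.smul_mem _ _ ?_
  rw [Finsupp.sum]
  refine Submodule.sum_mem _ fun t ht => ?_
  have hH : MZV.IsHoffman t := (hb t ht).1
  rw [rulesAssociator_binaryWord hH.isAdmissible, formalSpan_neg_one_pow_mul]
  refine Submodule.smul_mem _ _ (Submodule.smul_mem _ _ (Submodule.subset_span ?_))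
  exact ⟨⟨t, hH, (hb t ht).2⟩, rfl⟩

/-! ## Descent from `P_ℚ` to the crux's `ℤ`-form -/

/-- A finite family of rationals has a common denominator. [folklore] -/
theorem exists_common_den {ι : Type*} (S : Finset ι) (c : ι → ℚ) :
    ∃ D : ℕ, 0 < D ∧ ∀ i ∈ S, ∃ a : ℤ, (a : ℚ) = (D : ℚ) * c i := by
  classical
  refine ⟨∏ i ∈ S, (c i).den, Finset.prod_pos fun i _ => (c i).den_pos, fun i hi => ?_⟩
  obtain ⟨k, hk⟩ := Finset.dvd_prod_of_mem (fun i => (c i).den) hi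
  refine ⟨(k : ℤ) * (c i).num, ?_⟩
  rw [hk]
  push_cast
  rw [mul_comm ((c i).den : ℚ) (k : ℚ), mul_assoc, Rat.den_mul_eq_num]

/-- Natural multiples of a word class: `n • ⟦[Δ, c·ω_ε]⟧ = ⟦[Δ, (n c)·ω_ε]⟧` (integrand additivity). -/
theorem nsmul_mk_zWord {N : ℕ} (ε : Fin N → Bool) (c : ℚ) (n : ℕ) :
    n • (QuotientAddGroup.mk (zWord N ε c) : KZ.FormalRep ⧸ KZ.relations) =
      QuotientAddGroup.mk (zWord N ε (n * c)) := by
  induction n with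
  | zero => rw [zero_nsmul, Nat.cast_zero, zero_mul, mk_zWord_zero]
  | succ n ih => rw [succ_nsmul, ih, Nat.cast_succ, add_mul, one_mul, mk_zWord_add]

/-- Integer multiples of a word class. -/
theorem zsmul_mk_zWord {N : ℕ} (ε : Fin N → Bool) (c : ℚ) (n : ℤ) :
    n • (QuotientAddGroup.mk (zWord N ε c) : KZ.FormalRep ⧸ KZ.relations) =
      QuotientAddGroup.mk (zWord N ε (n * c)) := by
  obtain ⟨k, rfl | rfl⟩ := Int.eq_nat_or_neg n
  · rw [natCast_zsmul, nsmul_mk_zWord, Int.cast_natCast]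
  · rw [neg_zsmul, natCast_zsmul, nsmul_mk_zWord, Int.cast_neg, Int.cast_natCast, neg_mul]
    have h := mk_zWord_add ε ((k : ℚ) * c) (-((k : ℚ) * c))
    rw [add_neg_cancel, mk_zWord_zero] at h
    exact neg_eq_of_add_eq_zero_right h.symm

/-- An index of weight `N` with a given admissible word. -/
theorem exists_index' {N : ℕ} (ε : Fin N → Bool) (hε : Adm ε) :
    ∃ u : List ℕ, MZV.IsAdmissible u ∧ MZV.weight u = N ∧ bword N u = ε := by
  rcases Nat.eq_zero_or_pos N with rfl | hN
  · exact ⟨[], MZV.isAdmissible_nil, rfl, funext fun i => i.elim0⟩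
  · obtain ⟨u, hu, huw, hb⟩ := exists_index_of_adm hN ε hε
    refine ⟨u, hu, huw, funext fun i => ?_⟩
    simp [bword, wordOf, hb, List.getD_eq_getElem?_getD, i.isLt]

/-- **Descent.** Formal Hoffman spanning in `P_ℚ` (weight kept) gives the weight-`N` slice of the
crux: clear denominators, pull back along `P ↪ P_ℚ` (`IntegerDivision`), rescale by `q` (`scaleQ`),
divide by the common denominator (`IntegerDivision`), pass to an arbitrary generator by off-domain
freedom; a non-admissible word carries no representation (`Negative/Divergence`). -/
theorem spanAt_of_formalSpanW {N : ℕ}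
    (h : ∀ s : List ℕ, MZV.IsAdmissible s → MZV.weight s = N →
      toPeriodAlgebra (mzvClass s) ∈ Submodule.span ℚ (Set.range
        (fun t : {t : List ℕ // MZV.IsHoffman t ∧ MZV.weight t = MZV.weight s} =>
          toPeriodAlgebra (mzvClass t.1)))) :
    SpanAt N := by
  classical
  intro ε q s hd hi
  by_cases hε : Adm ε
  swap
  · exact ⟨0, zero_mem _, by simpa using of_mem_relations_of_not_adm s hd hi hε⟩
  obtain ⟨sidx, hadm, hsw, hbw⟩ := exists_index' ε hε
  subst hsw
  obtain ⟨c, hc⟩ := (Finsupp.mem_span_range_iff_exists_finsupp).1 (h sidx hadm rfl)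
  obtain ⟨D, hD, hden⟩ := exists_common_den c.support (fun t => c t)
  choose! a ha using hden
  have hD' : (D : ℚ) ≠ 0 := by exact_mod_cast hD.ne'
  -- the identity in `P`: `D • ⟦ζ(sidx)⟧ = Σ_t a_t • ⟦ζ(t)⟧`
  have hPid : (D : ℤ) • mzvClass sidx = ∑ t ∈ c.support, a t • mzvClass t.1 := by
    apply sectorKernel_toPeriodAlgebra_injective
    rw [map_zsmul, map_sum, ← hc, Finsupp.sum, Finset.smul_sum]
    refine Finset.sum_congr rfl fun t ht => ?_
    rw [map_zsmul, ← Int.cast_smul_eq_zsmul ℚ (D : ℤ), smul_smul, ← Int.cast_smul_eq_zsmul ℚ (a t),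
      ha t ht, Int.cast_natCast]
  -- the same identity as a relation in `KZ.FormalRep`
  have hcls : ∀ (u : List ℕ) (hu : MZV.IsAdmissible u), mzvClass u = toFormalPeriod (zIdx u 1) :=
    fun u hu => by rw [mzvClass_of_isAdmissible hu, zIdx_one_eq_of_mzvRep u hu]
  have hrel : (D : ℤ) • zIdx sidx 1 - ∑ t ∈ c.support, a t • zIdx t.1 1 ∈ KZ.relations := by
    rw [← toFormalPeriod_eq_zero_iff, map_sub, map_zsmul, map_sum, sub_eq_zero, ← hcls sidx hadm, hPid]
    exact Finset.sum_congr rfl fun t _ => by rw [map_zsmul, ← hcls t.1 t.2.1.isAdmissible]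
  -- pass to the quotient group and rescale by `q`
  have hQ : (D : ℤ) • (QuotientAddGroup.mk (zIdx sidx 1) : KZ.FormalRep ⧸ KZ.relations) =
      ∑ t ∈ c.support, a t • (QuotientAddGroup.mk (zIdx t.1 1) : KZ.FormalRep ⧸ KZ.relations) := by
    have := (QuotientAddGroup.eq_iff_sub_mem).mpr hrel
    simpa only [QuotientAddGroup.mk_zsmul, QuotientAddGroup.mk_sum] using this
  have hQq := congrArg (scaleQ q) hQ
  rw [map_zsmul, map_sum] at hQq
  simp only [map_zsmul, zIdx, scaleQ_mk_zWord, mul_one] at hQq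
  -- the Hoffman combination
  set m : KZ.FormalRep :=
    ∑ t ∈ c.support, zWord (MZV.weight sidx) (bword (MZV.weight sidx) t.1) ((a t : ℚ) * q / D) with hm
  have hmQ : (D : ℤ) • (QuotientAddGroup.mk m : KZ.FormalRep ⧸ KZ.relations) =
      ∑ t ∈ c.support, a t • (QuotientAddGroup.mk
        (zWord (MZV.weight t.1) (bword (MZV.weight t.1) t.1) q) : KZ.FormalRep ⧸ KZ.relations) := by
    rw [hm, QuotientAddGroup.mk_sum, Finset.smul_sum]
    refine Finset.sum_congr rfl fun t _ => ?_
    rw [zsmul_mk_zWord, zsmul_mk_zWord, zWord_bword_eq_zIdx t.2.2]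
    simp only [zIdx]
    congr 2
    push_cast
    rw [mul_div_assoc', mul_comm (D : ℚ) _, mul_div_assoc, div_self hD', mul_one]
  have hsQ : (QuotientAddGroup.mk (zWord (MZV.weight sidx) (bword (MZV.weight sidx) sidx) q) :
      KZ.FormalRep ⧸ KZ.relations) = QuotientAddGroup.mk (zWord (MZV.weight sidx) ε q) := by
    rw [hbw]
  have hdiff : (D : ℤ) • ((QuotientAddGroup.mk (zWord (MZV.weight sidx) ε q) :
      KZ.FormalRep ⧸ KZ.relations) - QuotientAddGroup.mk m) = 0 := by
    rw [smul_sub, ← hsQ, hQq, hmQ, sub_self]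
  have hrel' : (D : ℕ) • (zWord (MZV.weight sidx) ε q - m) ∈ KZ.relations := by
    rw [← natCast_zsmul, ← QuotientAddGroup.eq_zero_iff, QuotientAddGroup.mk_zsmul,
      QuotientAddGroup.mk_sub]
    exact hdiff
  have hrel'' : zWord (MZV.weight sidx) ε q - m ∈ KZ.relations :=
    Summit.KontsevichZagierPeriods.FurushoPentagon.integerDivision_proof _ D hD hrel'
  refine ⟨m, ?_, ?_⟩
  · rw [hm]
    refine sum_mem fun t _ => AddSubgroup.subset_closure ?_
    exact zWord_bword_mem_hoffmanGens t.2.1 t.2.2 _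
  · have h1 : KZ.of s - KZ.of (wordRep ε q hε) ∈ KZ.relations :=
      of_sub_of_wordRep_mem_relations hε s hd hi
    rw [zWord_of_adm hε] at hrel''
    have : KZ.of s - m = (KZ.of s - KZ.of (wordRep ε q hε)) + (KZ.of (wordRep ε q hε) - m) := by abel
    rw [this]
    exact add_mem h1 hrel''

/-! ## Composition: the crux through weight 17, and from the tail -/

/-- The weight slice from the double-shuffle leaf in that weight. -/
theorem spanAt_of_leafDS {N : ℕ} (h : ∀ s : List ℕ, MZV.IsAdmissible s → MZV.weight s = N → LeafDS s) :
    SpanAt N :=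
  spanAt_of_formalSpanW fun s hs hw => formalSpanW_of_leafDS hs (h s hs hw)

/-- **The crux through weight `17`, unconditionally**: every MZV word generator of weight `N ≤ 17` is
congruent modulo `KZ.relations` to a `ℤ`-combination of Hoffman generators of weight `N` — rungs `≤ 13`
of line `Sketch` (`spanAt_of_le_thirteen`) and the double-shuffle leaf in weights `14 … 17`
(`stub_dsLeaf_14_17`). -/
theorem spanAt_of_le_seventeen {N : ℕ} (h : N ≤ 17) : SpanAt N := by
  rcases Nat.lt_or_ge N 14 with h13 | h14
  · exact spanAt_of_le_thirteen (by omega)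
  · exact spanAt_of_leafDS fun s hs hw => stub_dsLeaf_14_17 s hs (by omega) (by omega)

/-- **Registered milestone `stub_leSeventeen`** of line `eds-ds`: the crux holds in every weight `≤ 17`. -/
theorem stub_leSeventeen : ∀ N : ℕ, N ≤ 17 → SpanAt N := fun _ h => spanAt_of_le_seventeen h

/-- The crux from the two leaf ranges (sorry-free composition of the skeleton, with the landed
`stub_dsLeaf_14_17` in the first slot). -/
theorem HoffmanSpanInKZ_of_dsTail
    (h₂ : ∀ s : List ℕ, MZV.IsAdmissible s → 18 ≤ MZV.weight s → LeafDS s) : HoffmanSpanInKZ := by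
  rw [hoffmanSpanInKZ_iff]
  intro N
  rcases Nat.lt_or_ge N 18 with h17 | h18
  · exact spanAt_of_le_seventeen (by omega)
  · exact spanAt_of_leafDS fun s hs hw => h₂ s hs (by omega)

/-- **Registered composition `stub_cruxOfDsTail`** of line `eds-ds`: the single open stub `stub_dsTail`
(IKZ 2006, Conjecture 1 in the weights `≥ 18`) implies the crux — the item is CLOSED MODULO it. -/
theorem stub_cruxOfDsTail :
    (∀ s : List ℕ, MZV.IsAdmissible s → 18 ≤ MZV.weight s → LeafDS s) → HoffmanSpanInKZ :=
  HoffmanSpanInKZ_of_dsTail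

/-- Read against the crux's own binders: for `w ≤ 17` the conclusion of `HoffmanSpanInKZ` holds. -/
theorem hoffmanSpanInKZ_of_weight_le_seventeen {w : ℕ} (hw : w ≤ 17) (ε : Fin w → Bool) (q : ℚ)
    (s : KZ.IntegralRep w) (hd : s.domain = {t | (∀ i, 0 < t i) ∧ (∀ i, t i < 1) ∧ StrictAnti t})
    (hi : Set.EqOn s.integrand (fun t => (q : ℝ) * ∏ i, if ε i then 1 / (1 - t i) else 1 / t i)
      s.domain) :
    ∃ m ∈ AddSubgroup.closure (hoffmanGens w), KZ.of s - m ∈ KZ.relations :=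
  spanAt_of_le_seventeen hw ε q s hd hi

end Summit.KontsevichZagierPeriods.LinRedNormalForm.HoffmanSpanInKZ
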